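import Literature.NumberTheory.Automorphic.QuadraticBaseChangeNonSelfTwistProofs
import Literature.NumberTheory.Automorphic.LanglandsTetrahedral
import Literature.NumberTheory.Automorphic.TunnellOctahedralLocal
import Literature.NumberTheory.EllipticCurves.TateModuleTraceOffIndexTwo
import Literature.NumberTheory.EllipticCurves.TateModuleIrreducibleFrobenius
import Literature.NumberTheory.EllipticCurves.FrobeniusTraceBaseChange
import Literature.NumberTheory.GaloisRepresentations.FrobeniusPlaces
import Literature.NumberTheory.GaloisRepresentations.FrobeniusDensity
import HarnessLib

/-!
# The non-twist hypothesis of cyclic base change for the representation of an elliptic curve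

Topic `Literature/NumberTheory/Automorphic`; a *proofs* file (theorems only: no definition, no
named fact, no instance), a brick of the discharge programme of
`Literature.NumberTheory.Automorphic.isModularEllipticCurve_baseChange_rat_of_isSolvable`
(modularity of `E₀ ⊗ K` for `E₀ / ℚ` and `K` totally real solvable, by cyclic base change of the
automorphic representation of `E₀` up a subnormal series of `Gal(K/ℚ)`; Thorne, *Automorphy of
some residually dihedral Galois representations*, Lemma 7.1 with `F = ℚ`).  Arthur–Clozel's
cuspidality criterion for cyclic base change of prime degree `p` (`baseChange_cyclic_cuspidal`,
Thm. III.4.2 (a): `BC_{E/F}(π)` is cuspidal iff `π ≇ π ⊗ ω` for the characters `ω` of `E / F`)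
is vendored in the tree in its Satake form: *at some place `v` of `F` inert in `E`, `π` has a
Satake parameter `α` with `ζ • α ≠ α` for every primitive `p`-th root of unity `ζ`*.  This file
supplies that hypothesis for the representations met along the tower, i.e. for an automorphic
representation `π` of `GL₂(𝔸_F)` whose Satake parameters at almost every place `v` are
`{λ_v/√q_v, μ_v/√q_v}` with `(X - λ_v)(X - μ_v) = X² - a_v(E₀ ⊗ F) X + q_v`:

* `exists_place_inertiaDeg_eq_one_of_finite` — a number field has places of residue degree one
  over rational primes outside any finite set (density of Frobenii);
* `exists_prime_gt_isIrreducible_rationalGaloisRepTate_baseChange` — **for every elliptic curve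
  `E₀ / ℚ` and every number field `L`, `V_ℓ(E₀ ⊗ L)` is an irreducible `ℚ_ℓ[Γ_L]`-module for
  arbitrarily large primes `ℓ`** (a degree-one place `w ∣ p` of good reduction, Hasse
  `a_p² < 4p`, a prime `ℓ` with `a_p² - 4p` a non-residue, and the Frobenius criterion
  `isIrreducible_rationalGaloisRepTate_of_frobenius`; no open-image input);
* `exists_inert_hasSatakeParamAt_map_ne_of_finrank_eq_two` — **the quadratic step**: for
  `[E : F] = 2` with `E` admitting a real place there is an inert `v` with `a_v(E₀ ⊗ F) ≠ 0`,
  hence `-α ≠ α` (Ribet 1977, §4, in Galois form: an element of `Γ_F ∖ res(Γ_E)` with non-zero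
  trace on `V_ℓ(E₀ ⊗ F)`, `exists_trace_rationalGaloisRepTate_ne_zero_of_not_mem_range`, the
  quadratic character `ε_E`, and the density of Frobenii in the open set
  `{ε_E = -1, tr ≠ 0}`);
* `exists_inert_hasSatakeParamAt_map_ne_of_prime_ne_two` — **the odd prime step**: for `E / F`
  Galois of odd prime degree `p` inert places exist (a Frobenius off `res(Γ_E)`;
  `placesOver_dichotomy_of_prime`) and at any of them `{ζx, ζy} = {x, y}` with `x y = 1` is
  impossible for `ζ` of order `p`;
* `exists_inert_hasSatakeParamAt_map_ne_of_prime` — the two cases combined, in the exact shape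
  of the hypothesis of `baseChange_cyclic_cuspidal` (`n = 2`).

## References

* J. Arthur, L. Clozel, *Simple algebras, base change, and the advanced theory of the trace
  formula*, Ann. of Math. Stud. 120 (1989), Ch. 3, Thm. 4.2 and Lemma 6.5. [ArthurClozel1989]
* R. P. Langlands, *Base change for GL(2)*, Ann. of Math. Stud. 96 (1980), Ch. 2.
  [LanglandsBaseChange1980]
* K. A. Ribet, *Galois representations attached to eigenforms with Nebentypus*, LNM 601 (1977),
  §4 (Prop. 4.4, Thm. 4.5). [Ribet1977Nebentypus]
* J. A. Thorne, *Automorphy of some residually dihedral Galois representations*, Math. Ann. 364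
  (2016), Lemma 7.1 and Thm. 7.6. [Thorne2016]
* J.-P. Serre, *Abelian ℓ-adic representations and elliptic curves* (1968), Ch. I §2.2 and
  Ch. IV §2.2. [SerreAbelianLadic1968]
* J. H. Silverman, *The arithmetic of elliptic curves*, 2nd ed. (2009), Thm. V.1.1, V.2.3.1,
  C.21. [SilvermanAEC2009]

## Design notes

No definition is introduced; the compatibility hypothesis is spelled out as the `∀ᶠ` clause
that the tower argument transports (`IsWeakBaseChangeLiftAE`), with `a_v` an arbitrary
integer-valued function in the odd case.  Imports stay inside `NumberTheory/Automorphic`,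
`NumberTheory/EllipticCurves`, `NumberTheory/GaloisRepresentations`.  No `sorry`, no new
instance; axioms `propext`, `Classical.choice`, `Quot.sound`.
-/

noncomputable section

open scoped MatrixGroups Matrix NumberField Polynomial
open NumberField IsDedekindDomain Field Polynomial Filter
open Literature.NumberTheory.GaloisRepresentations Literature.NumberTheory.EllipticCurves

namespace Literature.NumberTheory.Automorphic

/-! ### `V_ℓ(E ⊗ L)` is irreducible for a suitable prime `ℓ`, for every `E / ℚ` and every `L` -/

section Irreducible

open Rat.HeightOneSpectrum WeierstrassCurve
  Literature.NumberTheory.EllipticCurves.FrobeniusIrreducible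

/-- **A place of residue degree one outside any finite set** (density of Frobenii): for a number
field `L` and a finite set `S` of places of `ℚ`, there are a place `v ∉ S` of `ℚ` and a place
`w ∣ v` of `L` with `f(w|v) = 1`: the open subgroup `res(Γ_L) ≤ Γ_ℚ`
(`isOpen_range_absGaloisRestrict_and_index`) meets the dense set of arithmetic Frobenii at
places outside `S` (`absoluteGaloisGroup.frobenius_dense`, `chebotarev_artinRep_holds`), and a
Frobenius in `res(Γ_L)` lies under a place of degree one
(`inertiaDeg_eq_one_of_isArithFrobAt_absGaloisRestrict`, Marcus Ch. 4 Thm. 29).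
[cite: SerreAbelianLadic1968, Ch. I §2.2, Cor. 2 (a)] -/
theorem exists_place_inertiaDeg_eq_one_of_finite (L : Type) [Field L] [NumberField L]
    {S : Set (HeightOneSpectrum (𝓞 ℚ))} (hS : S.Finite) :
    ∃ (v : HeightOneSpectrum (𝓞 ℚ)) (w : HeightOneSpectrum (𝓞 L)), v ∉ S ∧
      w.asIdeal.under (𝓞 ℚ) = v.asIdeal ∧ w.asIdeal.inertiaDeg (𝓞 ℚ) = 1 := by
  classical
  obtain ⟨hopen, -⟩ := isOpen_range_absGaloisRestrict_and_index (F := ℚ) (K := L)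
  obtain ⟨σ, hσmem, v, hvS, 𝔓, h𝔓, hσ⟩ :=
    (absoluteGaloisGroup.frobenius_dense chebotarev_artinRep_holds ℚ S hS).inter_open_nonempty _
      hopen ⟨1, Subgroup.one_mem _⟩
  obtain ⟨τ, rfl⟩ : ∃ τ, absGaloisRestrict ℚ L τ = σ := hσmem
  obtain ⟨𝔔, w, h𝔔𝔓, hw, h𝔔⟩ := exists_place_comap_eq_smul (F := ℚ) (M := L) h𝔓 1
  rw [one_smul] at h𝔔𝔓
  refine ⟨v, w, hvS, hw, inertiaDeg_eq_one_of_isArithFrobAt_absGaloisRestrict (τ := τ) hw h𝔔 ?_⟩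
  rw [h𝔔𝔓]
  exact hσ

/-- **`V_ℓ(E ⊗ L)` is an irreducible `Γ_L`-module for infinitely many `ℓ`**, for EVERY elliptic
curve `E / ℚ` (with or without complex multiplication) and every number field `L`: take a place
`w` of `L` of residue degree one over a prime `p` of good reduction
(`exists_place_inertiaDeg_eq_one_of_finite`), so that `a_w(E ⊗ L) = a_p(E)`
(`frobeniusTraceAt_baseChange_eq_eval_dickson` with `f = 1`) and `q_w = p`; Hasse gives
`a_p² - 4p < 0` (`frobeniusTraceAt_sq_lt_four_mul`), so `a_p² - 4p` is a non-square modulo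
infinitely many primes `ℓ` (`exists_prime_gt_not_isSquare`, Dirichlet), and for such `ℓ > p`
the Frobenius at `w` has characteristic polynomial `X² - a_p X + p` without root modulo `ℓ` on
`T_ℓ(E ⊗ L)`, whence irreducibility (`isIrreducible_rationalGaloisRepTate_of_frobenius`).
[cite: SilvermanAEC2009, Thm. V.1.1 and C.21 Remark 21.3] -/
theorem exists_prime_gt_isIrreducible_rationalGaloisRepTate_baseChange (W : WeierstrassCurve ℚ)
    [W.IsElliptic] (L : Type) [Field L] [NumberField L] (N : ℕ) :
    ∃ (ℓ : ℕ) (_ : Fact ℓ.Prime), N < ℓ ∧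
      haveI : (W.baseChange L).IsElliptic := by rw [WeierstrassCurve.baseChange]; infer_instance
      ((W.baseChange L).rationalGaloisRepTate ℓ).IsIrreducible := by
  classical
  haveI hEL : (W.baseChange L).IsElliptic := by rw [WeierstrassCurve.baseChange]; infer_instance
  -- a place `w` of `L` of degree one over a good prime `p`
  have hS : {v : HeightOneSpectrum (𝓞 ℚ) | ¬ W.HasGoodReductionAt v}.Finite :=
    Filter.eventually_cofinite.mp W.eventually_hasGoodReductionAt
  obtain ⟨v, w, hvS, hw, hf1⟩ := exists_place_inertiaDeg_eq_one_of_finite L hS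
  have hgood : W.HasGoodReductionAt v := not_not.mp hvS
  haveI : w.asIdeal.LiesOver v.asIdeal := ⟨hw.symm⟩
  set p : ℕ := (primesEquiv v : ℕ) with hpdef
  have hpp : p.Prime := (primesEquiv v).2
  -- the auxiliary prime `ℓ`
  have hD : W.frobeniusTraceAt v ^ 2 - 4 * (p : ℤ) < 0 := by
    have h := W.frobeniusTraceAt_sq_lt_four_mul hgood
    rw [← hpdef] at h
    linarith
  obtain ⟨ℓ, hℓN, hℓ, hsq⟩ := exists_prime_gt_not_isSquare hD (max N p)
  have hNℓ : N < ℓ := lt_of_le_of_lt (le_max_left _ _) hℓN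
  have hpℓ : p ≠ ℓ := (lt_of_le_of_lt (le_max_right N p) hℓN).ne
  haveI : Fact ℓ.Prime := ⟨hℓ⟩
  refine ⟨ℓ, ⟨hℓ⟩, hNℓ, ?_⟩
  -- `w ∤ ℓ`, good reduction of `E ⊗ L` at `w`
  have hℓv : (ℓ : 𝓞 ℚ) ∉ v.asIdeal := natCast_not_mem_asIdeal_of_primesEquiv_ne hℓ hpℓ
  have hℓw : (ℓ : 𝓞 L) ∉ w.asIdeal := by
    intro h
    apply hℓv
    rw [← hw, Ideal.under_def, Ideal.mem_comap, map_natCast]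
    exact h
  have hgoodw : (W.baseChange L).HasGoodReductionAt w :=
    hasGoodReductionAt_baseChange_of_hasGoodReductionAt W L v w hgood
  -- `a_w = a_p`, `q_w = p`
  have haw : (W.baseChange L).frobeniusTraceAt w = W.frobeniusTraceAt v := by
    rw [W.frobeniusTraceAt_baseChange_eq_eval_dickson L hw hgood, hf1, Polynomial.dickson_one,
      Polynomial.eval_X]
  have hqw : Nat.card (IsLocalRing.ResidueField (w.adicCompletionIntegers L)) = p := by
    rw [WeierstrassCurve.natCard_residueField_eq_residueCard,
      residueCard_eq_residueCard_pow_inertiaDeg hw, hf1, pow_one, Rat.residueCard_eq_natGenerator]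
    rfl
  refine isIrreducible_rationalGaloisRepTate_of_frobenius (W.baseChange L) ℓ hℓw hgoodw fun x ↦ ?_
  rw [haw, hqw]
  refine ne_zero_of_not_isSquare_discr ?_ x
  push_cast at hsq
  exact hsq

end Irreducible

/-! ### The non-twist hypothesis of `baseChange_cyclic_cuspidal` for the representation of `E` -/

section NonTwist

open WeierstrassCurve

variable {F : Type} [Field F] [NumberField F]

/-- The rational prime `ℓ` lies in only finitely many places of a number field. [folklore] -/
theorem eventually_natCast_prime_not_mem (ℓ : ℕ) [Fact ℓ.Prime] :
    ∀ᶠ v : HeightOneSpectrum (𝓞 F) in cofinite, (ℓ : 𝓞 F) ∉ v.asIdeal := by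
  have hne : Ideal.span {(ℓ : 𝓞 F)} ≠ ⊥ := by
    rw [Ne, Ideal.span_singleton_eq_bot]
    exact_mod_cast (Fact.out : ℓ.Prime).ne_zero
  refine Filter.mem_of_superset (Ideal.finite_factors hne).compl_mem_cofinite ?_
  intro v hv hmem
  exact hv (Ideal.dvd_span_singleton.2 hmem)

open scoped Classical in
/-- **The quadratic step: an inert place with `a_v ≠ 0`** (Galois form of Ribet 1977, §4: a
non-CM-by-`E` representation has `a_v ≠ 0` at some inert `v`).  Let `E₀ / ℚ` be an elliptic
curve, `F` a number field, `E / F` a quadratic extension with a real place, and `π` an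
automorphic representation of `GL₂(𝔸_F)` whose Satake parameters at almost every `v` are
`{λ_v/√q_v, μ_v/√q_v}` with `(X - λ_v)(X - μ_v) = X² - a_v(E₀ ⊗ F) X + q_v`.  Then at some
place `v` of `F` inert in `E`, `π` has a Satake parameter `α` with `-α ≠ α`.  Proof: for a prime
`ℓ` with `V_ℓ(E₀ ⊗ E)` irreducible (`exists_prime_gt_isIrreducible_rationalGaloisRepTate_baseChange`)
some `γ ∈ Γ_F ∖ res(Γ_E)` has non-zero trace on `V_ℓ(E₀ ⊗ F)`
(`exists_trace_rationalGaloisRepTate_ne_zero_of_not_mem_range`: complex conjugation and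
Burnside); the open set `{ε_E = -1} ∩ {tr ρ_{E₀ ⊗ F,ℓ} ≠ 0}` then contains an arithmetic
Frobenius `Φ` at a good place `v ∤ ℓ` unramified in `E` where `π` is compatible with `E₀`
(`absoluteGaloisGroup.frobenius_dense`, `chebotarev_artinRep_holds`); `ε_E(Φ) = -1` forces `v`
inert, and `-α = α` would give `a_v = √q_v Σ α = 0 = tr ρ(Φ)`
(`hasFrobCharpolyAt_rationalTateGaloisRepOf_of_hasGoodReductionAt`), a contradiction.
[cite: Ribet1977Nebentypus, §4 (Prop. 4.4, Thm. 4.5)]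
[cite: LanglandsBaseChange1980, Ch. 2, non-twist hypothesis `π ≇ π ⊗ ω`] -/
theorem exists_inert_hasSatakeParamAt_map_ne_of_finrank_eq_two (W : WeierstrassCurve ℚ)
    [W.IsElliptic] (E : Type) [Field E] [NumberField E] [Algebra F E] (φ : E →+* ℝ)
    (hdeg : Module.finrank F E = 2) {hcpt : isCompact_glFiniteIntegralLevel 2 F}
    (π : AutomorphicRepData (AutomorphyDatum.gl 2 F hcpt))
    (hπ : ∀ᶠ v : HeightOneSpectrum (𝓞 F) in cofinite, ∃ α : Multiset ℂ,
      π.HasSatakeParamAt v α ∧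
        (α.map fun z => X - C ((((Real.sqrt (v.residueCard : ℝ)) : ℝ) : ℂ) * z)).prod =
          X ^ 2 - C (((W.baseChange F).frobeniusTraceAt v : ℤ) : ℂ) * X +
            C ((v.residueCard : ℕ) : ℂ)) :
    ∃ (v : HeightOneSpectrum (𝓞 F)) (w : HeightOneSpectrum (𝓞 E)) (α : Multiset ℂ),
      w.asIdeal.under (𝓞 F) = v.asIdeal ∧ w.asIdeal.inertiaDeg (𝓞 F) = Module.finrank F E ∧
      π.HasSatakeParamAt v α ∧
      ∀ ζ : ℂ, IsPrimitiveRoot ζ (Module.finrank F E) → α.map (ζ * ·) ≠ α := by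
  classical
  haveI hWF : (W.baseChange F).IsElliptic := by rw [WeierstrassCurve.baseChange]; infer_instance
  by_contra H
  push Not at H
  -- (0) `E/F` is Galois; a copy `L ⊆ F̄` of `E` with `res(Γ_E) = Gal(F̄/L)`
  haveI : FiniteDimensional F E := Module.finite_of_finrank_pos (by rw [hdeg]; exact two_pos)
  haveI : Algebra.IsQuadraticExtension F E := ⟨hdeg⟩
  haveI : IsGalois F E := inferInstance
  obtain ⟨e, he⟩ := exists_mem_range_absGaloisRestrict_iff F E
  obtain ⟨L, hLdef⟩ : ∃ L, L = e.fieldRange := ⟨_, rfl⟩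
  let e' : E ≃ₐ[F] L := e.equivFieldRange.trans (IntermediateField.equivOfEq hLdef.symm)
  haveI := e'.toLinearEquiv.finiteDimensional
  haveI hGL := IsGalois.of_algEquiv e'
  haveI : NumberField L := NumberField.of_module_finite F L
  have hL2 : Module.finrank F L = 2 := e'.toLinearEquiv.finrank_eq ▸ hdeg
  have hcard : Nat.card (L ≃ₐ[F] L) = 2 := (IsGalois.card_aut_eq_finrank F L).trans hL2
  haveI : IsCyclic (L ≃ₐ[F] L) := isCyclic_of_prime_card (p := 2) hcard
  haveI : IsMulCommutative (L ≃ₐ[F] L) := IsCyclic.isMulCommutative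
  have hcomm : ∀ a b : L ≃ₐ[F] L, Commute a b := fun a b => IsMulCommutative.is_comm.comm a b
  -- (1) a prime `ℓ` with `V_ℓ(E₀ ⊗ E)` irreducible
  obtain ⟨ℓ, hℓinst, -, hirrE⟩ :=
    exists_prime_gt_isIrreducible_rationalGaloisRepTate_baseChange W E 0
  haveI := hℓinst
  haveI hWFE : ((W.baseChange F).baseChange E).IsElliptic := by
    rw [WeierstrassCurve.baseChange]; infer_instance
  have hWE : (W.baseChange F).baseChange E = W.baseChange E := by
    rw [WeierstrassCurve.baseChange, WeierstrassCurve.baseChange, WeierstrassCurve.baseChange,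
      WeierstrassCurve.map_map]
    exact congrArg W.map (Subsingleton.elim _ _)
  have hirr : (((W.baseChange F).baseChange E).rationalGaloisRepTate ℓ).IsIrreducible := by
    have key : ∀ (W₁ W₂ : WeierstrassCurve E) (h₁ : W₁.IsElliptic) (h₂ : W₂.IsElliptic),
        W₁ = W₂ → (W₂.rationalGaloisRepTate ℓ).IsIrreducible →
          (W₁.rationalGaloisRepTate ℓ).IsIrreducible := by
      rintro W₁ _ h₁ h₂ rfl h
      exact h
    exact key _ _ hWFE (by rw [WeierstrassCurve.baseChange]; infer_instance) hWE hirrE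
  -- (2) an element `γ ∉ res(Γ_E)` with non-zero trace on `V_ℓ(E₀ ⊗ F)`
  have hne : ((absGaloisRestrict F E).range : Subgroup (absoluteGaloisGroup F)) ≠ ⊤ := by
    intro htop
    have hidx := (isOpen_range_absGaloisRestrict_and_index F E).2
    rw [htop, Subgroup.index_top, hdeg] at hidx
    exact absurd hidx (by decide)
  obtain ⟨γ, hγres, hγtr⟩ :=
    (W.baseChange F).exists_trace_rationalGaloisRepTate_ne_zero_of_not_mem_range E ℓ φ hirr hne
  -- the framed representation `ρ = ρ_{E₀ ⊗ F, ℓ}` and its trace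
  set ρ := (W.baseChange F).framedTateGaloisRep ℓ with hρ
  haveI := (W.baseChange F).module_finite_rationalTateModule_holds ℓ
  have htrace : ∀ g, FramedRep.trace ρ g = algebraMap ℚ_[ℓ] (PadicAlgCl ℓ)
      (LinearMap.trace ℚ_[ℓ] _ ((W.baseChange F).rationalGaloisRepTate ℓ g)) := by
    intro g
    rw [hρ, FramedRep.trace, WeierstrassCurve.framedTateGaloisRep_def,
      WeierstrassCurve.coe_framedTateGaloisRepOfBasis_apply, ← AddMonoidHom.map_trace,
      ← LinearMap.trace_eq_matrix_trace]
    rfl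
  have hγtr' : FramedRep.trace ρ γ ≠ 0 := by
    rw [htrace]
    exact fun h => hγtr ((map_eq_zero_iff _ (algebraMap ℚ_[ℓ] (PadicAlgCl ℓ)).injective).mp h)
  -- (3) the quadratic character `ε` of `L`; `ε γ = -1`
  obtain ⟨ε, hεL, hεN, -⟩ := exists_quadraticGaloisChar L (PadicAlgCl ℓ) hcard
  have hγL : absRestrictNormalHom L γ ≠ 1 := by
    intro h1
    apply hγres
    rw [he]
    intro x
    rw [absRestrictNormalHom_eq_one_iff, IntermediateField.mem_fixingSubgroup_iff] at h1
    have hx : e x ∈ L := by rw [hLdef]; exact ⟨x, rfl⟩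
    have h2 := h1 (e x) hx
    rwa [absoluteGaloisGroup.smul_def]
  have hεγ : ε γ = -1 := hεN γ hγL
  have h11 : ((-1 : (PadicAlgCl ℓ)ˣ)) ≠ 1 := fun h ↦ by
    have h2 : ((-1 : (PadicAlgCl ℓ)ˣ) : PadicAlgCl ℓ) = ((1 : (PadicAlgCl ℓ)ˣ) : PadicAlgCl ℓ) := by
      rw [h]
    rw [Units.val_neg, Units.val_one] at h2
    exact two_ne_zero (α := PadicAlgCl ℓ) (by linear_combination -h2)
  -- (4) the open set `{ε = -1, tr ρ ≠ 0}` and a Frobenius in it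
  set U : Set (absoluteGaloisGroup F) := {g | ε g ≠ 1} ∩ {g | FramedRep.trace ρ g ≠ 0} with hU
  have hUo : IsOpen U :=
    (isOpen_ne_fun (map_continuous ε) continuous_const).inter
      (isOpen_ne_fun (FramedRep.continuous_trace ρ) continuous_const)
  have hγU : γ ∈ U := ⟨by rw [Set.mem_setOf_eq, hεγ]; exact h11, hγtr'⟩
  set S : Set (HeightOneSpectrum (𝓞 F)) := {v | ¬ ((((∃ α : Multiset ℂ,
      π.HasSatakeParamAt v α ∧
        (α.map fun z => X - C ((((Real.sqrt (v.residueCard : ℝ)) : ℝ) : ℂ) * z)).prod =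
          X ^ 2 - C (((W.baseChange F).frobeniusTraceAt v : ℤ) : ℂ) * X +
            C ((v.residueCard : ℕ) : ℂ)) ∧
      (W.baseChange F).HasGoodReductionAt v) ∧ (ℓ : 𝓞 F) ∉ v.asIdeal) ∧
      Algebra.IsUnramifiedIn (𝓞 L) v.asIdeal)} with hS
  have hSfin : S.Finite := by
    have h := ((hπ.and (W.baseChange F).eventually_hasGoodReductionAt).and
      (eventually_natCast_prime_not_mem (F := F) ℓ)).and (eventually_isUnramifiedIn (K := F) L)
    rwa [eventually_cofinite] at h
  obtain ⟨Φ, ⟨hΦε, hΦtr⟩, v, hvS, 𝔓, h𝔓, hΦ⟩ :=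
    (absoluteGaloisGroup.frobenius_dense chebotarev_artinRep_holds F S hSfin).inter_open_nonempty
      U hUo ⟨γ, hγU⟩
  have hv : (((∃ α : Multiset ℂ, π.HasSatakeParamAt v α ∧
        (α.map fun z => X - C ((((Real.sqrt (v.residueCard : ℝ)) : ℝ) : ℂ) * z)).prod =
          X ^ 2 - C (((W.baseChange F).frobeniusTraceAt v : ℤ) : ℂ) * X +
            C ((v.residueCard : ℕ) : ℂ)) ∧
      (W.baseChange F).HasGoodReductionAt v) ∧ (ℓ : 𝓞 F) ∉ v.asIdeal) ∧
      Algebra.IsUnramifiedIn (𝓞 L) v.asIdeal := by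
    by_contra h; exact hvS h
  obtain ⟨⟨⟨⟨α, hα, hprod⟩, hgood⟩, hℓv⟩, hvL⟩ := hv
  -- (5) `v` is inert in `E`
  haveI : IsGaloisGroup (E ≃ₐ[F] E) (𝓞 F) (𝓞 E) := IsGaloisGroup.of_isFractionRing _ _ _ F E
  obtain ⟨w, hw⟩ := exists_above (E := E) v
  have hf2 : w.asIdeal.inertiaDeg (𝓞 F) = 2 := by
    rcases inertiaDeg_eq_one_or_two_of_finrank_eq_two hdeg v w hw with hf1 | hf2
    · exfalso
      haveI : w.asIdeal.LiesOver v.asIdeal := ⟨hw.symm⟩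
      haveI := v.isMaximal
      have hIn : v.asIdeal.inertiaDegIn (𝓞 L) = 1 := by
        rw [← inertiaDegIn_eq_of_algEquiv e' v.asIdeal,
          Ideal.inertiaDegIn_eq_inertiaDeg v.asIdeal w.asIdeal (E ≃ₐ[F] E)]
        exact hf1
      exact hΦε (hεL Φ
        (absRestrictNormalHom_eq_one_of_isArithFrobAt_of_inertiaDegIn_eq_one hcomm hvL hIn h𝔓 hΦ))
    · exact hf2
  obtain ⟨ζ, hζ, hαζ⟩ := H v w α hw (hf2.trans hdeg.symm) hα
  rw [hdeg] at hζ
  obtain rfl : ζ = -1 := hζ.eq_neg_one_of_two_right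
  -- (6) `α = {x, y}` with `{-x, -y} = {x, y}`, so `x + y = 0` and `a_v = √q_v (x + y) = 0`
  obtain ⟨x, y, rfl⟩ := Multiset.card_eq_two.mp hα.card_eq
  have hsum : x + y = 0 := by
    have h1 := congrArg Multiset.sum hαζ
    simp only [Multiset.insert_eq_cons, Multiset.map_cons, Multiset.map_singleton,
      Multiset.sum_cons, Multiset.sum_singleton, neg_mul, one_mul] at h1
    linear_combination -h1 / 2
  set c : ℂ := (((Real.sqrt (v.residueCard : ℝ)) : ℝ) : ℂ) with hc
  have hav : (((W.baseChange F).frobeniusTraceAt v : ℤ) : ℂ) = 0 := by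
    simp only [Multiset.insert_eq_cons, Multiset.map_cons, Multiset.map_singleton,
      Multiset.prod_cons, Multiset.prod_singleton] at hprod
    have emul : (X - C (c * x)) * (X - C (c * y)) =
        X ^ 2 - C (c * x + c * y) * X + C (c * x * (c * y)) := by
      simp only [map_add, map_mul]; ring
    rw [emul] at hprod
    have e3 := congrArg (fun P : ℂ[X] ↦ P.coeff 1) hprod
    simp only [coeff_add, coeff_sub, coeff_C_mul, coeff_X_pow, coeff_X_one, coeff_C,
      if_neg (one_ne_zero), if_neg (show (1 : ℕ) ≠ 2 by decide)] at e3
    have e4 : (((W.baseChange F).frobeniusTraceAt v : ℤ) : ℂ) = c * x + c * y := by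
      linear_combination e3
    rw [e4, ← mul_add, hsum, mul_zero]
  have hav' : (W.baseChange F).frobeniusTraceAt v = 0 := by exact_mod_cast hav
  -- (7) the trace of the Frobenius `Φ` on `V_ℓ(E₀ ⊗ F)` is `a_v = 0`: contradiction
  have hPv : ρ.HasFrobCharpolyAt v
      ((X ^ 2 - C ((W.baseChange F).frobeniusTraceAt v : ℚ_[ℓ]) * X +
        C (Nat.card (IsLocalRing.ResidueField (v.adicCompletionIntegers F)) : ℚ_[ℓ])).map
          (algebraMap ℚ_[ℓ] (PadicAlgCl ℓ))) :=
    ((W.baseChange F).hasFrobCharpolyAt_framedTateGaloisRep_iff ℓ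
        ((W.baseChange F).continuous_rationalGaloisRepTate_holds ℓ) v _).2
      ((W.baseChange F).hasFrobCharpolyAt_rationalTateGaloisRepOf_of_hasGoodReductionAt
        ((W.baseChange F).trace_galoisRepTate_frobenius_of_hasGoodReductionAt_holds ℓ)
        ((W.baseChange F).det_galoisRepTate_frobenius_of_hasGoodReductionAt_holds ℓ) _ hℓv hgood)
  have hch := hPv 𝔓 h𝔓 Φ hΦ
  rw [hav', Int.cast_zero, map_zero, zero_mul, sub_zero, Polynomial.map_add, Polynomial.map_pow,
    Polynomial.map_X, Polynomial.map_C, map_natCast (algebraMap ℚ_[ℓ] (PadicAlgCl ℓ))] at hch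
  -- `hch : charpoly (ρ Φ) = X² + q`, whose `X`-coefficient (minus the trace) vanishes
  have htrΦ : FramedRep.trace ρ Φ = 0 := by
    rw [FramedRep.trace, Matrix.trace_eq_neg_charpoly_coeff, Fintype.card_fin]
    change -((FramedRep.charpoly ρ Φ).coeff (2 - 1)) = 0
    rw [hch]
    simp only [coeff_add, coeff_X_pow, coeff_C, show (2 - 1 : ℕ) = 1 from rfl, if_neg (one_ne_zero),
      if_neg (show (1 : ℕ) ≠ 2 by decide), add_zero, neg_zero]
  exact hΦtr htrΦ

open scoped Classical in
/-- **The odd prime step: any unramified compatible place that is inert.**  Let `E / F` be a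
cyclic extension of number fields of odd prime degree `p` and `π` an automorphic representation
of `GL₂(𝔸_F)` whose Satake parameters at almost every `v` are `{λ_v/√q_v, μ_v/√q_v}` with
`λ_v μ_v = q_v` (`(X - λ_v)(X - μ_v) = X² - a_v X + q_v`, `a_v ∈ ℤ`).  Then at some place `v` of
`F` inert in `E` (these have positive density: a Frobenius off `res(Γ_E)`, by
`absoluteGaloisGroup.frobenius_dense` and `chebotarev_artinRep_holds`, generates the decomposition
group, `eq_galFrob`, so `f_v ≠ 1`, and `f_v ∈ {1, p}`, `placesOver_dichotomy_of_prime`) `π` has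
a Satake parameter `α = {x, y}`, `x y = 1`, with `ζ • α ≠ α` for every primitive `p`-th root of
unity `ζ`: `{ζx, ζy} = {x, y}` forces `ζ = 1` or `ζ² = 1`, impossible for `p` odd.  (The
non-twist hypothesis `π ≇ π ⊗ ω`, `ω` of order `p`, of Arthur–Clozel's Thm. III.4.2 is automatic
for `GL₂` and `p` odd: compare central characters.)
[cite: ArthurClozel1989, Ch. 3, Thm. 4.2 (a) and Lemma 6.5] -/
theorem exists_inert_hasSatakeParamAt_map_ne_of_prime_ne_two (E : Type) [Field E] [NumberField E]
    [Algebra F E] [IsGalois F E] (hp : (Module.finrank F E).Prime) (hp2 : Module.finrank F E ≠ 2)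
    {hcpt : isCompact_glFiniteIntegralLevel 2 F} (π : AutomorphicRepData (AutomorphyDatum.gl 2 F hcpt))
    (a : HeightOneSpectrum (𝓞 F) → ℤ)
    (hπ : ∀ᶠ v : HeightOneSpectrum (𝓞 F) in cofinite, ∃ α : Multiset ℂ,
      π.HasSatakeParamAt v α ∧
        (α.map fun z => X - C ((((Real.sqrt (v.residueCard : ℝ)) : ℝ) : ℂ) * z)).prod =
          X ^ 2 - C ((a v : ℤ) : ℂ) * X + C ((v.residueCard : ℕ) : ℂ)) :
    ∃ (v : HeightOneSpectrum (𝓞 F)) (w : HeightOneSpectrum (𝓞 E)) (α : Multiset ℂ),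
      w.asIdeal.under (𝓞 F) = v.asIdeal ∧ w.asIdeal.inertiaDeg (𝓞 F) = Module.finrank F E ∧
      π.HasSatakeParamAt v α ∧
      ∀ ζ : ℂ, IsPrimitiveRoot ζ (Module.finrank F E) → α.map (ζ * ·) ≠ α := by
  classical
  by_contra H
  push Not at H
  -- (0) a copy `L ⊆ F̄` of `E`, Galois and cyclic of order `p` over `F`
  haveI : FiniteDimensional F E := Module.finite_of_finrank_pos hp.pos
  obtain ⟨e, he⟩ := exists_mem_range_absGaloisRestrict_iff F E
  obtain ⟨L, hLdef⟩ : ∃ L, L = e.fieldRange := ⟨_, rfl⟩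
  let e' : E ≃ₐ[F] L := e.equivFieldRange.trans (IntermediateField.equivOfEq hLdef.symm)
  haveI := e'.toLinearEquiv.finiteDimensional
  haveI hGL := IsGalois.of_algEquiv e'
  haveI : NumberField L := NumberField.of_module_finite F L
  have hLp : Module.finrank F L = Module.finrank F E := e'.toLinearEquiv.finrank_eq.symm
  have hcard : Nat.card (L ≃ₐ[F] L) = Module.finrank F E :=
    (IsGalois.card_aut_eq_finrank F L).trans hLp
  haveI : IsCyclic (L ≃ₐ[F] L) := by
    haveI : Fact (Module.finrank F E).Prime := ⟨hp⟩
    exact isCyclic_of_prime_card hcard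
  haveI : IsMulCommutative (L ≃ₐ[F] L) := IsCyclic.isMulCommutative
  have hcomm : ∀ a b : L ≃ₐ[F] L, Commute a b := fun a b => IsMulCommutative.is_comm.comm a b
  -- (1) an element `γ ∈ Γ_F` with non-trivial image in `Gal(L/F)`
  obtain ⟨σ₀, hσ₀⟩ : ∃ σ₀ : L ≃ₐ[F] L, σ₀ ≠ 1 := by
    by_contra h
    push Not at h
    haveI : Subsingleton (L ≃ₐ[F] L) := ⟨fun a b => (h a).trans (h b).symm⟩
    rw [Nat.card_of_subsingleton (1 : L ≃ₐ[F] L)] at hcard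
    exact hp.one_lt.ne hcard
  obtain ⟨γ, hγ⟩ := absRestrictNormalHom_surjective L σ₀
  -- (2) the open set `{g | g|_L ≠ 1}` and a Frobenius in it
  set U : Set (absoluteGaloisGroup F) := {g | absRestrictNormalHom L g ≠ 1} with hU
  have hUo : IsOpen U := by
    have hcl : IsClosed (((absRestrictNormalHom L).ker : Subgroup (absoluteGaloisGroup F)) :
        Set (absoluteGaloisGroup F)) :=
      Subgroup.isClosed_of_isOpen _ (isOpen_ker_absRestrictNormalHom L)
    have hUeq : U = ((((absRestrictNormalHom L).ker : Subgroup (absoluteGaloisGroup F)) :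
        Set (absoluteGaloisGroup F)))ᶜ := by
      ext g
      rw [Set.mem_compl_iff, SetLike.mem_coe, MonoidHom.mem_ker, hU, Set.mem_setOf_eq]
    rw [hUeq]
    exact hcl.isOpen_compl
  have hγU : γ ∈ U := by rw [hU, Set.mem_setOf_eq, hγ]; exact hσ₀
  set S : Set (HeightOneSpectrum (𝓞 F)) := {v | ¬ (((∃ α : Multiset ℂ,
      π.HasSatakeParamAt v α ∧
        (α.map fun z => X - C ((((Real.sqrt (v.residueCard : ℝ)) : ℝ) : ℂ) * z)).prod =
          X ^ 2 - C ((a v : ℤ) : ℂ) * X + C ((v.residueCard : ℕ) : ℂ)) ∧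
      Algebra.IsUnramifiedIn (𝓞 E) v.asIdeal) ∧ Algebra.IsUnramifiedIn (𝓞 L) v.asIdeal)} with hS
  have hSfin : S.Finite := by
    have hE : ∀ᶠ v : HeightOneSpectrum (𝓞 F) in cofinite, Algebra.IsUnramifiedIn (𝓞 E) v.asIdeal := by
      rw [eventually_cofinite]; exact finite_setOf_not_isUnramifiedIn F E
    have h := (hπ.and hE).and (eventually_isUnramifiedIn (K := F) L)
    rwa [eventually_cofinite] at h
  obtain ⟨Φ, hΦU, v, hvS, 𝔓, h𝔓, hΦ⟩ :=
    (absoluteGaloisGroup.frobenius_dense chebotarev_artinRep_holds F S hSfin).inter_open_nonempty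
      U hUo ⟨γ, hγU⟩
  have hv : ((∃ α : Multiset ℂ, π.HasSatakeParamAt v α ∧
        (α.map fun z => X - C ((((Real.sqrt (v.residueCard : ℝ)) : ℝ) : ℂ) * z)).prod =
          X ^ 2 - C ((a v : ℤ) : ℂ) * X + C ((v.residueCard : ℕ) : ℂ)) ∧
      Algebra.IsUnramifiedIn (𝓞 E) v.asIdeal) ∧ Algebra.IsUnramifiedIn (𝓞 L) v.asIdeal := by
    by_contra h; exact hvS h
  obtain ⟨⟨⟨α, hα, hprod⟩, hvE⟩, hvL⟩ := hv
  -- (3) `v` is inert in `E`: its Frobenius class in `Gal(L/F)` is `Φ|_L ≠ 1`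
  haveI : 𝔓.IsPrime := h𝔓.1
  have hP := comap_ringOfIntegersToIntegralClosure_mem_primesOver_of_mem_primesAbove L h𝔓
  have hrΦ := isArithFrobAt_absRestrictNormalHom L hΦ
  have heq : absRestrictNormalHom L Φ = galFrob F L v := eq_galFrob hcomm hvL hP hrΦ
  have hfne : v.asIdeal.inertiaDegIn (𝓞 L) ≠ 1 := by
    intro h1
    have h := Automorphic.galFrob_pow_inertiaDegIn_eq_one (F := F) (L := L) hvL
    rw [h1, pow_one] at h
    exact hΦU (heq.trans h)
  haveI : IsGaloisGroup (E ≃ₐ[F] E) (𝓞 F) (𝓞 E) := IsGaloisGroup.of_isFractionRing _ _ _ F E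
  obtain ⟨w, hw⟩ := exists_above (E := E) v
  have hfw : w.asIdeal.inertiaDeg (𝓞 F) = Module.finrank F E := by
    rcases placesOver_dichotomy_of_prime (F := F) (M := E) hp hvE with ⟨-, h⟩ | ⟨-, h⟩
    · exfalso
      haveI : w.asIdeal.LiesOver v.asIdeal := ⟨hw.symm⟩
      haveI := v.isMaximal
      apply hfne
      rw [← inertiaDegIn_eq_of_algEquiv e' v.asIdeal,
        Ideal.inertiaDegIn_eq_inertiaDeg v.asIdeal w.asIdeal (E ≃ₐ[F] E)]
      exact h w (HeightOneSpectrum.ext hw)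
    · exact h w (HeightOneSpectrum.ext hw)
  obtain ⟨ζ, hζ, hαζ⟩ := H v w α hw hfw hα
  -- (4) `α = {x, y}` with `x ≠ 0` (`q_v x y = q_v ≠ 0` up to `√q_v`) and `{ζx, ζy} = {x, y}`
  obtain ⟨x, y, rfl⟩ := Multiset.card_eq_two.mp hα.card_eq
  set c : ℂ := (((Real.sqrt (v.residueCard : ℝ)) : ℝ) : ℂ) with hc
  simp only [Multiset.insert_eq_cons, Multiset.map_cons, Multiset.map_singleton,
    Multiset.prod_cons, Multiset.prod_singleton] at hprod
  have hx0 : x ≠ 0 := by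
    intro hx0
    have e0 := congrArg (Polynomial.eval 0) hprod
    simp only [Polynomial.eval_mul, Polynomial.eval_sub, Polynomial.eval_add,
      Polynomial.eval_pow, Polynomial.eval_X, Polynomial.eval_C, hx0, mul_zero, sub_zero,
      zero_mul] at e0
    have hq : ((v.residueCard : ℕ) : ℂ) = 0 := by linear_combination -e0
    exact (Nat.cast_eq_zero.mp hq ▸ v.one_lt_residueCard |> fun h => by omega)
  simp only [Multiset.insert_eq_cons, Multiset.map_cons, Multiset.map_singleton] at hαζ
  rw [Multiset.cons_eq_cons] at hαζ
  rcases hαζ with ⟨h1, -⟩ | ⟨-, cs, h1, h2⟩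
  · -- `ζ x = x`, so `ζ = 1`
    have hζ1 : ζ = 1 := by
      have h : (ζ - 1) * x = 0 := by linear_combination h1
      rcases mul_eq_zero.mp h with h | h
      · linear_combination h
      · exact absurd h hx0
    rw [hζ1] at hζ
    exact hp.one_lt.ne' (IsPrimitiveRoot.one_left_iff.mp hζ)
  · -- `ζ x = y` and `ζ y = x`, so `ζ² = 1` and `p ∣ 2`
    rw [Multiset.singleton_eq_cons_iff] at h2
    obtain ⟨hy, rfl⟩ := h2
    rw [Multiset.cons_zero, Multiset.singleton_inj] at h1
    have hζ2 : ζ ^ 2 = 1 := by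
      have h : (ζ ^ 2 - 1) * x = 0 := by
        have h' : ζ * (ζ * x) = x := by rw [← hy]; exact h1
        linear_combination h'
      rcases mul_eq_zero.mp h with h | h
      · linear_combination h
      · exact absurd h hx0
    have hdvd : Module.finrank F E ∣ 2 := hζ.dvd_of_pow_eq_one 2 hζ2
    rcases (Nat.dvd_prime Nat.prime_two).mp hdvd with h | h
    · exact hp.one_lt.ne' h
    · exact hp2 h

open scoped Classical in
/-- **The non-twist hypothesis of cyclic base change for the representation attached to an
elliptic curve over `ℚ`, up a totally real step of prime degree.**  Let `E₀ / ℚ` be an elliptic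
curve, `E / F` a cyclic extension of number fields of prime degree with `E` admitting a real
place, and `π` an automorphic representation of `GL₂(𝔸_F)` whose Satake parameters at almost
every place match `E₀ ⊗ F` (unitary normalisation: `∏ (X - √q_v αᵢ) = X² - a_v(E₀ ⊗ F) X + q_v`).
Then the hypothesis of `baseChange_cyclic_cuspidal` holds: at some place `v` of `F` inert in `E`,
`π` has a Satake parameter `α` with `ζ • α ≠ α` for every primitive `[E:F]`-th root of unity `ζ`
(`exists_inert_hasSatakeParamAt_map_ne_of_finrank_eq_two` for `[E:F] = 2`,
`exists_inert_hasSatakeParamAt_map_ne_of_prime_ne_two` otherwise).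
[cite: ArthurClozel1989, Ch. 3, Thm. 4.2 (a)] [cite: Ribet1977Nebentypus, §4 (Thm. 4.5)] -/
theorem exists_inert_hasSatakeParamAt_map_ne_of_prime (W : WeierstrassCurve ℚ) [W.IsElliptic]
    (E : Type) [Field E] [NumberField E] [Algebra F E] [IsGalois F E] (φ : E →+* ℝ)
    (hp : (Module.finrank F E).Prime) {hcpt : isCompact_glFiniteIntegralLevel 2 F}
    (π : AutomorphicRepData (AutomorphyDatum.gl 2 F hcpt))
    (hπ : ∀ᶠ v : HeightOneSpectrum (𝓞 F) in cofinite, ∃ α : Multiset ℂ,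
      π.HasSatakeParamAt v α ∧
        (α.map fun z => X - C ((((Real.sqrt (v.residueCard : ℝ)) : ℝ) : ℂ) * z)).prod =
          X ^ 2 - C (((W.baseChange F).frobeniusTraceAt v : ℤ) : ℂ) * X +
            C ((v.residueCard : ℕ) : ℂ)) :
    ∃ (v : HeightOneSpectrum (𝓞 F)) (w : HeightOneSpectrum (𝓞 E)) (α : Multiset ℂ),
      w.asIdeal.under (𝓞 F) = v.asIdeal ∧ w.asIdeal.inertiaDeg (𝓞 F) = Module.finrank F E ∧
      π.HasSatakeParamAt v α ∧
      ∀ ζ : ℂ, IsPrimitiveRoot ζ (Module.finrank F E) → α.map (ζ * ·) ≠ α := by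
  by_cases h2 : Module.finrank F E = 2
  · exact exists_inert_hasSatakeParamAt_map_ne_of_finrank_eq_two W E φ h2 π hπ
  · exact exists_inert_hasSatakeParamAt_map_ne_of_prime_ne_two E hp h2 π
      (fun v => (W.baseChange F).frobeniusTraceAt v) hπ

end NonTwist

end Literature.NumberTheory.Automorphic
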